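import Summits.Ventures.PercRepro.C041TriangleLeafStar3A
import Summits.Ventures.PercRepro.C041TriangleLeafStar3B
import Summits.Ventures.PercRepro.C041TriangleLeafStar3C
import Summits.Ventures.PercRepro.C041TriangleLeafStar3D
import Summits.Ventures.PercRepro.C041TriangleLeafStar3E
import Summits.Ventures.PercRepro.C041TriangleLeafStar3F
import Summits.Ventures.PercRepro.C041TriangleLeafStar3G
import Summits.Ventures.PercRepro.C041TriangleLeafStar3H
import Summits.Ventures.PercRepro.C041TriangleLeafStar3I
import Summits.Ventures.PercRepro.C041TriangleLeafStar3J
import Summits.Ventures.PercRepro.C041TriangleLeafStar3K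
import Summits.Ventures.PercRepro.C041TriangleLeafStar3L

/-!
# THEOREM (LEAF × THREE-LEAF STAR) — coordinate 0 of the identity `θ_△(v d, v a * v b * v c) = leafStar3A a b c d + leafStar3B a b c d + leafStar3C a b c d + leafStar3D a b c d + leafStar3E a b c d + leafStar3F a b c d + leafStar3G a b c d + leafStar3H a b c d + leafStar3I a b c d + leafStar3J a b c d + leafStar3K a b c d + leafStar3L a b c d` (mine-3, gen 67; C-041.md §21 (bg)): the
explicit certificate's coordinate 0 agrees with the triangle map's, by `ring` over the parts' definitions (one
coordinate per module: the six expansions of 1630 terms each exceed one farm node together).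
-/

namespace PercRepro

namespace RelaxedTriangle

open TreeClosure

set_option maxHeartbeats 800000 in
/-- Coordinate 0 of the identity. -/
theorem thetaTri_leafStar3_coord0 (a b c d : ℝ) :
    thetaTri (v d) (v a * v b * v c) 0 = (leafStar3A a b c d + leafStar3B a b c d + leafStar3C a b c d + leafStar3D a b c d + leafStar3E a b c d + leafStar3F a b c d + leafStar3G a b c d + leafStar3H a b c d + leafStar3I a b c d + leafStar3J a b c d + leafStar3K a b c d + leafStar3L a b c d) 0 := by
  simp only [leafStar3A, leafStar3B, leafStar3C, leafStar3D, leafStar3E, leafStar3F, leafStar3G, leafStar3H, leafStar3I, leafStar3J, leafStar3K, leafStar3L, leafStar3A1, leafStar3A2, leafStar3A3, leafStar3B1, leafStar3B2, leafStar3C1, leafStar3C2, leafStar3D1, leafStar3D2, leafStar3D3, leafStar3D4, leafStar3D5, leafStar3D6, leafStar3E1, leafStar3E2, leafStar3E3, leafStar3E4, leafStar3E5, leafStar3E6, leafStar3E7, leafStar3E8, leafStar3F1, leafStar3F2, leafStar3F3, leafStar3F4, leafStar3F5, leafStar3F6, leafStar3F7, leafStar3F8, leafStar3G1, leafStar3G2,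 leafStar3G3, leafStar3G4, leafStar3G5, leafStar3G6, leafStar3G7, leafStar3G8, leafStar3H1, leafStar3H2, leafStar3I1, leafStar3I2, leafStar3I3, leafStar3J1, leafStar3J2, leafStar3J3, leafStar3K1, leafStar3K2, leafStar3K3, leafStar3L1, thetaTri_eq_vec, Pi.add_apply, Pi.smul_apply, Pi.mul_apply, Pi.one_apply, smul_eq_mul, v]
  simp
  ring

end RelaxedTriangle

end PercRepro
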